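/-
Copyright (c) 2026 the pub-hodgecm-mathlib formalisation cell (harness21).  Prover seat hodgecm-mathlib-K2E3-p03 (g6), Track B «K2-LIT» ∕ h413
(`stmt-HodgeConjecture-24833`), line `K2_E3_EllipticInputs`, road (11-3-split-nsc), leaf (nsc-S-A′) `sig_K2E3GL3PrincipalBlockStandardSpan` (owner K2E3-p25 (g0)),
line «IH-x×x×x» (lead K2E3-p03 (g6) by D78; dealer K2E3-plan (g4)), brick IH-2c: THE `6 × 6` IWAHORI–HECKE MATRICES OF `1 × 1 × 1` ON `GL₃(F)` AND `End ↪ scalars` ON `I^{Iw}`.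
2026-09-04.
-/
import Summits.HodgeConjecture.HodgeConjecture.Theorems.K2E3GLnIwahoriHeckeOperators     -- ★ IH-2b (this seat): two-case formula, `e_K` ∘ intertwiners, coordinates; brings ★ IH-2a, ★ IH-1
import Summits.HodgeConjecture.HodgeConjecture.Theorems.K2E3GL3IwahoriModuleIrreducible   -- ★ IH-4 (K2E3-p11 (g6)): `eq_smul_one_of_commute` (commutant of `T₁, T₂, P` is scalar)
import Summits.HodgeConjecture.HodgeConjecture.Theorems.K2E3GL3BorelModulus              -- ★ K2E3-p14: `rootDeltaChar_borel_three` (`δ_B^{1∕2}(b) = ‖b₀₀‖ ‖b₂₂‖⁻¹`)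
import Literature.NumberTheory.GaloisRepresentations.LocalFieldProofs                     -- ★ `normAbs_uniformizer_holds` (`‖ϖ‖ = q⁻¹`)
import Literature.NumberTheory.GaloisRepresentations.LocalExistenceLubinTate             -- ★ `valuation_le_unifValue_iff_lt_one`, `unifValue`
import HarnessLib

/-!
# K2_E3 road (h413), leaf (nsc-S-A′), line «IH-x×x×x», brick IH-2c: the Iwahori–Hecke matrices of the unramified principal series of `GL₃(F)` in the basis
# `φ_w` (`w ∈ S₃` in lexicographic order) ARE K2E3-p11's literals `T₁, T₂, P` of ★ IH-4, hence every `G`-endomorphism of `1 × 1 × 1` is a SCALAR on `I^{Iw}`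

Cell `pub/hodgecm-mathlib` (D-0151), Track B, seat K2E3-p03 (g6), LEAD of line «IH-x×x×x» (dealer D78); architect K2E3-p25.  `--supports stmt-HodgeConjecture-24833 --as helper`;
THEOREMS ONLY (no definition ∕ instance ∕ notation ∕ named fact ∕ `sorry`); never imports `Cruxes/…/Lines`.  COUNT-NEUTRAL helper.

NOTATION (inline).  `I = I(𝟙) = parabolicIndGL F id (𝟙.twist 1)` on `GL₃(F)` (`= Ind_B^{GL₃} δ_B^{1∕2} = 1 × 1 × 1`), `Iw = iwahoriGL 3 F`, `e = I.avgProj Iw`, `P_w = permGL w`, `q = |𝓀[F]|`,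
`φ_σ` an Iwahori basis (`φ_σ ∈ I^{Iw}`, `φ_σ(P_τ) = [τ = σ]`, ★ IH-1 `exists_iwahoriBasisFun`), `ι = ![1, (1 2), (0 1), (0 1 2), (0 2 1), (0 2)] : Fin 6 → S₃` = the permutations
`(w 0, w 1, w 2) ∈ [(012),(021),(102),(120),(201),(210)]` (lexicographic) = K2E3-p11 (g6)'s basis order `m_w` (`IH4_check.v1.K2E3-p11-g6.md`), `r = P_{(0 1 2)} · diag(ϖ, 1, 1)`
(`= [[0,1,0],[0,0,1],[ϖ,0,0]]`, normalises `Iw`), MATRIX OF AN OPERATOR `A` := `(a, b) ↦ (A φ_{ι b})(P_{ι a})` (column `b` = coordinates of `A φ_{ι b}`).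

THE MATHEMATICS [IwahoriMatsumoto1965, §3]; [Borel1976, §3–§4]; [Casselman1980, §3]; the dictionary `m_w ↔ φ_w` with `T₁ = q·e∘π(P_{(0 1)})`, `T₂ = q·e∘π(P_{(1 2)})`, `P = π(r⁻¹)` was
found by brute force over all `6!` orders (`K2/K2E3-p03/g6/match_tables.py`) and is PROVED here entry by entry:
* §1 (any `n`, any `χ`) the `(τ, σ)` ENTRY of `q·e∘π(P_s)` (`s = (i, i+1)`) in an Iwahori basis: `q·[σ = sτ]` if `τ⁻¹ i < τ⁻¹ (i+1)`, else `[σ = sτ] + (q−1)[σ = τ]`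
  (`entry_hecke_swap`, from ★ IH-2b `toFun_avgProj_permGL_swap_apply`) — Iwahori–Matsumoto's `T_s`.
* §2 (`n = 3`, `χ = 1`) `r` NORMALISES `Iw` (`conj_r_mem_iwahori`, entrywise with `|k_{a0}| ≤ |ϖ|` below the diagonal), so `π(r⁻¹)` preserves `I^{Iw}`; its `(τ, σ)` entry is
  `[σ = (0 2 1)τ] · δ_B^{1∕2}(diag(ϖ⁻¹ at τ⁻¹(0)))` `∈ {q, 1, q⁻¹}` (`entry_R`, ★ `rootDeltaChar_borel_three`, ★ `‖ϖ‖ = q⁻¹`).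
* §3 THE TABLES: in the order `ι` these entries ARE the literal `T₁, T₂, P` of ★ IH-4 (`table_T₁`, `table_T₂`, `table_P`; 3 × 36 entries by `decide` on `S₃`).
* §4 **`exists_smul_of_intertwiningMap`**: for every intertwining operator `Φ` of `I(𝟙)`, the matrix `X` of `Φ|_{I^{Iw}}` commutes with `T₁, T₂, P` (★ IH-2b: `e` commutes with `Φ`,
  matrices multiply), so ★ IH-4 gives `X = X₀₀ · 1`, i.e. **`∃ c, ∀ f ∈ I^{Iw}, Φ f = c • f`** — the input of IH-5 (`End_G(I) = ℂ` ⇒ irreducible by unitarity + IH-3).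
HONEST LABEL: HC_CM is proved only modulo the 7 printed citations (2 remaining named inputs: hLiu418 = stmt-HodgeConjecture-24832, h413 = stmt-HodgeConjecture-24833)
until rung 0 closes; count-neutral helper (no printed citation is discharged).

## Mathlib ∕ tree search
Tree ★: IH-2b `toFun_avgProj_permGL_swap_apply`∕`apply_avgProj_eq_avgProj_apply`∕`avgProj_apply_mem_fixedPoints`∕`toFun_apply_apply_eq_sum_mul`∕`eq_sum_toFun_smul_basis`, IH-2a
`toFun_permGL_mul_diagonalGL_mul_permGL`, IH-1 `exists_iwahoriBasisFun`, IH-4 `eq_smul_one_of_commute`, `rootDeltaChar_borel_three` (K2E3GL3BorelModulus), `normAbs_uniformizer_holds`,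
`valuation_le_unifValue_iff_lt_one`, `coe_permGL_mul_mul_inv`, `coe_diagonalGL`, `diagonalGL_mem_borel`, `avgProjLinear`, `mem_iwahoriGL_iff`, `mem_glInt_of_isIntegralMatrix`.
Mathlib: `Valuation.exists_isUniformizer_of_isCyclic_of_nontrivial`, `Matrix.diagonal_mul`, `Matrix.mul_diagonal`, `Equiv.sum_comp`, `Equiv.ofBijective`.
Dedup: `rg "table_T₁|entry_hecke_swap|exists_smul_of_intertwiningMap|conj_r_mem_iwahori"` over `Literature Summits` — no hits.

## References
* [IwahoriMatsumoto1965] N. Iwahori, H. Matsumoto, Publ. Math. IHÉS 25 (1965), §3.  * [Borel1976] A. Borel, Invent. Math. 35 (1976), §3–§4.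
* [Casselman1980] W. Casselman, Compositio Math. 40 (1980), §3.  * [CartierCorvallis1979] P. Cartier, PSPM 33.1 (1979), §IV.1.
-/

set_option autoImplicit false
-- the mandated namespace repeats the single-problem summit's segment (`HodgeConjecture.HodgeConjecture`)
set_option linter.dupNamespace false

noncomputable section

open Matrix
open scoped MatrixGroups NNReal
open Literature.NumberTheory.Automorphic ValuativeRel
open Literature.NumberTheory.GaloisRepresentations Literature.NumberTheory.GaloisRepresentations.IsNonarchimedeanLocalField
open Summit.HodgeConjecture.HodgeConjecture.Cruxes.H413

namespace Summit.HodgeConjecture.HodgeConjecture.Cruxes.H413.K2E3GL3IwahoriHeckeMatrices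

/-! ## §1 The entries of `q · e_{Iw} π(P_s)` in an Iwahori basis (any `n`, any `χ`) -/

section HeckeEntry

variable {F : Type} [Field F] [ValuativeRel F] [TopologicalSpace F] [IsNonarchimedeanLocalField F] {n : ℕ}
  (χ : (Π a : Fin n, GL {i : Fin n // (id : Fin n → Fin n) i = a} F) →* ℂˣ)

/-- **Iwahori–Matsumoto's `T_s` in coordinates**: the `(τ, σ)` entry of `q · e_{Iw} π(P_s)` (`s = (i, i+1)`) in an Iwahori basis `φ` is `q·[σ = sτ]` if `τ⁻¹ i < τ⁻¹ (i+1)`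
and `[σ = sτ] + (q − 1)[σ = τ]` otherwise. [cite: IwahoriMatsumoto1965, §3 Thm. 3.3] [cite: Borel1976, §3–§4] -/
theorem entry_hecke_swap {i j : Fin n} (hij : (j : ℕ) = i + 1)
    (φ : Equiv.Perm (Fin n) → Representation.SmoothInd (standardParabolicGL F (id : Fin n → Fin n))
      (Representation.twist (((Representation.trivial ℂ (Π a : Fin n, GL {i : Fin n // (id : Fin n → Fin n) i = a} F) ℂ).twist χ).comp
        (leviProjection F (id : Fin n → Fin n))) (rootDeltaChar (standardParabolicGL F (id : Fin n → Fin n)))))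
    (hφ : ∀ σ, φ σ ∈ (Representation.parabolicIndGL F (id : Fin n → Fin n)
      ((Representation.trivial ℂ (Π a : Fin n, GL {i : Fin n // (id : Fin n → Fin n) i = a} F) ℂ).twist χ)).fixedPoints (iwahoriGL n F))
    (hφv : ∀ σ τ, (φ σ).toFun (permGL τ) = if τ = σ then 1 else 0) (σ τ : Equiv.Perm (Fin n)) :
    ((Nat.card 𝓀[F] : ℂ) • (Representation.parabolicIndGL F (id : Fin n → Fin n)
        ((Representation.trivial ℂ (Π a : Fin n, GL {i : Fin n // (id : Fin n → Fin n) i = a} F) ℂ).twist χ)).avgProj (iwahoriGL n F)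
      (Representation.parabolicIndGL F (id : Fin n → Fin n)
        ((Representation.trivial ℂ (Π a : Fin n, GL {i : Fin n // (id : Fin n → Fin n) i = a} F) ℂ).twist χ) (permGL (Equiv.swap i j)) (φ σ))).toFun
        (permGL τ) =
      if τ⁻¹ i < τ⁻¹ j then (Nat.card 𝓀[F] : ℂ) * (if Equiv.swap i j * τ = σ then 1 else 0)
      else (if Equiv.swap i j * τ = σ then 1 else 0) + ((Nat.card 𝓀[F] : ℂ) - 1) * (if τ = σ then 1 else 0) := by
  have hq0 : ((Nat.card 𝓀[F] : ℂ)) ≠ 0 := Nat.cast_ne_zero.2 (Nat.card_pos (α := 𝓀[F])).ne'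
  rw [Representation.SmoothInd.toFun_smul, Pi.smul_apply, smul_eq_mul, K2E3GLnIwahoriHeckeOperators.toFun_avgProj_permGL_swap_apply χ hij τ (hφ σ),
    hφv, hφv]
  split_ifs <;> field_simp

end HeckeEntry

/-! ## §2 `GL₃`, `χ = 1`: the element `r = P_{(0 1 2)} diag(ϖ, 1, 1)` normalises `Iw`; the entries of `π(r⁻¹)` -/

section GL3

variable {F : Type} [Field F] [ValuativeRel F] [TopologicalSpace F] [IsNonarchimedeanLocalField F]

/-- **`r Iw r⁻¹ ⊆ Iw`** for `r = P_{(0 1 2)} · diag(ϖ, 1, 1)` (`ϖ` a uniformizer): the conjugate `(r k r⁻¹)_{ab} = ϖ^{[ca = 0]} k_{ca, cb} ϖ^{−[cb = 0]}` (`c = (0 1 2)`) is integral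
(`|k_{a0}| ≤ |ϖ|` below the diagonal) and upper triangular mod `𝓂`. [cite: IwahoriMatsumoto1965, §3 (the length-0 element)] [cite: BruhatTits1972, (4.4.3)] -/
theorem conj_r_mem_iwahori {ϖ : F} (hϖ : (valuation F).IsUniformizer ϖ) {k : GL (Fin 3) F} (hk : k ∈ iwahoriGL 3 F) :
    (permGL (finRotate 3) * diagonalGL (Fin 3) F ![Units.mk0 ϖ hϖ.ne_zero, 1, 1]) * k *
      (permGL (finRotate 3) * diagonalGL (Fin 3) F ![Units.mk0 ϖ hϖ.ne_zero, 1, 1])⁻¹ ∈ iwahoriGL 3 F := by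
  have hkint : k ∈ glInt 3 F := iwahoriGL_le_glInt 3 F hk
  have hkO : ∀ a b, (k : Matrix (Fin 3) (Fin 3) F) a b ∈ 𝒪[F] := apply_mem_integer_of_mem_glInt hkint
  have hklt : ∀ a b : Fin 3, b < a → valuation F ((k : Matrix (Fin 3) (Fin 3) F) a b) < 1 := ((mem_iwahoriGL_iff k).1 hk).2
  have hϖv : valuation F ϖ = unifValue F := hϖ
  have hϖ1 : valuation F ϖ < 1 := hϖv ▸ unifValue_lt_one F
  have hϖO : ϖ ∈ 𝒪[F] := (Valuation.mem_integer_iff _ _).2 hϖ1.le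
  -- below-diagonal entries divided by `ϖ` stay integral
  have hdiv : ∀ a b : Fin 3, b < a → (k : Matrix (Fin 3) (Fin 3) F) a b * ϖ⁻¹ ∈ 𝒪[F] := by
    intro a b hab
    rw [Valuation.mem_integer_iff, map_mul, map_inv₀, hϖv]
    have h := (valuation_le_unifValue_iff_lt_one F _).2 (hklt a b hab)
    calc valuation F ((k : Matrix (Fin 3) (Fin 3) F) a b) * (unifValue F)⁻¹ ≤ unifValue F * (unifValue F)⁻¹ := mul_le_mul' h le_rfl
      _ = 1 := mul_inv_cancel₀ (unifValue_ne_zero F)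
  -- products with `ϖ` of integral entries are in `𝓂`
  have hmulϖ : ∀ a b : Fin 3, valuation F (ϖ * (k : Matrix (Fin 3) (Fin 3) F) a b) < 1 := fun a b => by
    rw [map_mul]
    exact mul_lt_one_of_lt_of_le hϖ1 (valuation_apply_le_one_of_mem_glInt hkint a b)
  -- the entries of the conjugate: `(r k r⁻¹)_{ab} = e_a · k_{c a, c b} · e_b⁻¹`, `c = (0 1 2) = ![1, 2, 0]`, `e = ![1, 1, ϖ]`
  have hc : ∀ a : Fin 3, finRotate 3 a = ![(1 : Fin 3), 2, 0] a := by decide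
  have he : ∀ a : Fin 3, ((![Units.mk0 ϖ hϖ.ne_zero, 1, 1] : Fin 3 → Fˣ) (finRotate 3 a) : F) = ![(1 : F), 1, ϖ] a := by
    intro a; fin_cases a <;> rfl
  have he' : ∀ a : Fin 3, (((![Units.mk0 ϖ hϖ.ne_zero, 1, 1] : Fin 3 → Fˣ)⁻¹ (finRotate 3 a) : Fˣ) : F) = (![(1 : F), 1, ϖ] a)⁻¹ := by
    intro a; fin_cases a <;> simp
  have hentry : ∀ a b : Fin 3, (((permGL (finRotate 3) * diagonalGL (Fin 3) F ![Units.mk0 ϖ hϖ.ne_zero, 1, 1]) * k *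
      (permGL (finRotate 3) * diagonalGL (Fin 3) F ![Units.mk0 ϖ hϖ.ne_zero, 1, 1])⁻¹ : GL (Fin 3) F) : Matrix (Fin 3) (Fin 3) F) a b =
      ![(1 : F), 1, ϖ] a * (k : Matrix (Fin 3) (Fin 3) F) (![(1 : Fin 3), 2, 0] a) (![(1 : Fin 3), 2, 0] b) * (![(1 : F), 1, ϖ] b)⁻¹ := by
    intro a b
    rw [show (permGL (finRotate 3) * diagonalGL (Fin 3) F ![Units.mk0 ϖ hϖ.ne_zero, 1, 1]) * k *
        (permGL (finRotate 3) * diagonalGL (Fin 3) F ![Units.mk0 ϖ hϖ.ne_zero, 1, 1])⁻¹ =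
        permGL (finRotate 3) * (diagonalGL (Fin 3) F ![Units.mk0 ϖ hϖ.ne_zero, 1, 1] * k * (diagonalGL (Fin 3) F ![Units.mk0 ϖ hϖ.ne_zero, 1, 1])⁻¹) *
          (permGL (finRotate 3))⁻¹ by group,
      coe_permGL_mul_mul_inv, Matrix.submatrix_apply, ← map_inv, Units.val_mul, Units.val_mul, coe_diagonalGL, coe_diagonalGL, Matrix.mul_diagonal,
      Matrix.diagonal_mul, he, he', hc, hc]
  have hϖcancel : ∀ x : F, ϖ * x * ϖ⁻¹ = x := fun x => by rw [mul_comm ϖ x, mul_assoc, mul_inv_cancel₀ hϖ.ne_zero, mul_one]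
  rw [mem_iwahoriGL_iff]
  refine ⟨mem_glInt_of_isIntegralMatrix (fun a b => ?_) ?_, fun a b hba => ?_⟩
  · rw [hentry]
    fin_cases a <;> fin_cases b <;>
      simp only [Fin.isValue, Matrix.cons_val_zero, Matrix.cons_val_one, Matrix.cons_val_two, Matrix.head_cons, Matrix.tail_cons, Fin.mk_one, Fin.zero_eta,
        Fin.reduceFinMk, one_mul, inv_one, mul_one, hϖcancel] <;>
      first
        | exact hkO _ _
        | exact hdiv _ _ (by decide)
        | exact mul_mem hϖO (hkO _ _)
  · rw [← Matrix.GeneralLinearGroup.val_det_apply, map_mul, map_mul, map_inv, mul_inv_cancel_comm, Matrix.GeneralLinearGroup.val_det_apply]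
    exact valuation_det_eq_one_of_mem_glInt hkint
  · rw [hentry]
    fin_cases a <;> fin_cases b <;> simp only [Fin.lt_def] at hba <;> norm_num at hba <;>
      simp only [Fin.isValue, Matrix.cons_val_zero, Matrix.cons_val_one, Matrix.cons_val_two, Matrix.head_cons, Matrix.tail_cons, Fin.mk_one, Fin.zero_eta,
        Fin.reduceFinMk, one_mul, inv_one, mul_one] <;>
      first
        | exact hklt _ _ (by decide)
        | exact hmulϖ _ _

/-- **`π(r⁻¹)` preserves `I^{Iw}`** (`r` normalises `Iw`): for `f ∈ I(χ)^{Iw}` (any `χ` on `GL₃`), `π(r⁻¹) f ∈ I(χ)^{Iw}`. [cite: IwahoriMatsumoto1965, §3] [cite: Borel1976, §3] -/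
theorem apply_rInv_mem_fixedPoints {ϖ : F} (hϖ : (valuation F).IsUniformizer ϖ)
    (χ : (Π a : Fin 3, GL {i : Fin 3 // (id : Fin 3 → Fin 3) i = a} F) →* ℂˣ)
    {f : Representation.SmoothInd (standardParabolicGL F (id : Fin 3 → Fin 3))
      (Representation.twist (((Representation.trivial ℂ (Π a : Fin 3, GL {i : Fin 3 // (id : Fin 3 → Fin 3) i = a} F) ℂ).twist χ).comp
        (leviProjection F (id : Fin 3 → Fin 3))) (rootDeltaChar (standardParabolicGL F (id : Fin 3 → Fin 3))))}
    (hf : f ∈ (Representation.parabolicIndGL F (id : Fin 3 → Fin 3)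
      ((Representation.trivial ℂ (Π a : Fin 3, GL {i : Fin 3 // (id : Fin 3 → Fin 3) i = a} F) ℂ).twist χ)).fixedPoints (iwahoriGL 3 F)) :
    Representation.parabolicIndGL F (id : Fin 3 → Fin 3)
        ((Representation.trivial ℂ (Π a : Fin 3, GL {i : Fin 3 // (id : Fin 3 → Fin 3) i = a} F) ℂ).twist χ)
        (permGL (finRotate 3) * diagonalGL (Fin 3) F ![Units.mk0 ϖ hϖ.ne_zero, 1, 1])⁻¹ f ∈
      (Representation.parabolicIndGL F (id : Fin 3 → Fin 3)
        ((Representation.trivial ℂ (Π a : Fin 3, GL {i : Fin 3 // (id : Fin 3 → Fin 3) i = a} F) ℂ).twist χ)).fixedPoints (iwahoriGL 3 F) := by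
  rw [Representation.mem_fixedPoints] at hf ⊢
  intro k hk
  rw [← Module.End.mul_apply, ← map_mul,
    show k * (permGL (finRotate 3) * diagonalGL (Fin 3) F ![Units.mk0 ϖ hϖ.ne_zero, 1, 1])⁻¹ =
      (permGL (finRotate 3) * diagonalGL (Fin 3) F ![Units.mk0 ϖ hϖ.ne_zero, 1, 1])⁻¹ *
        ((permGL (finRotate 3) * diagonalGL (Fin 3) F ![Units.mk0 ϖ hϖ.ne_zero, 1, 1]) * k *
          (permGL (finRotate 3) * diagonalGL (Fin 3) F ![Units.mk0 ϖ hϖ.ne_zero, 1, 1])⁻¹) by group,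
    map_mul, Module.End.mul_apply, hf _ (conj_r_mem_iwahori hϖ hk)]

/-- `δ_B^{1∕2}` of a DIAGONAL element of `GL₃(F)`: `‖e₀‖ · ‖e₂‖⁻¹` (★ `rootDeltaChar_borel_three`). [cite: BernsteinZelevinsky1977, 1.7 and §2.3] -/
theorem rootDeltaChar_diagonalGL_three (e : Fin 3 → Fˣ) :
    ((rootDeltaChar (standardParabolicGL F (id : Fin 3 → Fin 3)) ⟨diagonalGL (Fin 3) F e, diagonalGL_mem_borel _⟩ : ℂˣ) : ℂ) =
      (((normAbs F (e 0 : F) * (normAbs F (e 2 : F))⁻¹ : ℝ≥0) : ℝ) : ℂ) := by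
  rw [K2E3GL3BorelModulus.rootDeltaChar_borel_three]
  simp only [coe_diagonalGL, Matrix.diagonal_apply_eq]

/-- **The entries of `π(r⁻¹)` in an Iwahori basis of `I(𝟙)`** (`χ = 1`): `(π(r⁻¹) φ_σ)(P_τ) = [σ = (0 2 1)·τ] · ‖d̃(τ 0)‖ ‖d̃(τ 2)‖⁻¹` with `d̃ = (ϖ⁻¹, 1, 1)`, i.e. the factor is
`q, 1, q⁻¹` according as `τ⁻¹(0) = 0, 1, 2` (★ IH-2a torus move, `δ_B^{1∕2}`, `‖ϖ‖ = q⁻¹`). [cite: IwahoriMatsumoto1965, §3] [cite: Casselman1980, §3] -/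
theorem entry_R {ϖ : F} (hϖ : (valuation F).IsUniformizer ϖ)
    (φ : Equiv.Perm (Fin 3) → Representation.SmoothInd (standardParabolicGL F (id : Fin 3 → Fin 3))
      (Representation.twist (((Representation.trivial ℂ (Π a : Fin 3, GL {i : Fin 3 // (id : Fin 3 → Fin 3) i = a} F) ℂ).twist 1).comp
        (leviProjection F (id : Fin 3 → Fin 3))) (rootDeltaChar (standardParabolicGL F (id : Fin 3 → Fin 3)))))
    (hφv : ∀ σ τ, (φ σ).toFun (permGL τ) = if τ = σ then 1 else 0) (σ τ : Equiv.Perm (Fin 3)) :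
    (Representation.parabolicIndGL F (id : Fin 3 → Fin 3)
        ((Representation.trivial ℂ (Π a : Fin 3, GL {i : Fin 3 // (id : Fin 3 → Fin 3) i = a} F) ℂ).twist 1)
        (permGL (finRotate 3) * diagonalGL (Fin 3) F ![Units.mk0 ϖ hϖ.ne_zero, 1, 1])⁻¹ (φ σ)).toFun (permGL τ) =
      (((normAbs F ((((![Units.mk0 ϖ hϖ.ne_zero, 1, 1] : Fin 3 → Fˣ)⁻¹ (τ 0) : Fˣ) : F)) *
          (normAbs F ((((![Units.mk0 ϖ hϖ.ne_zero, 1, 1] : Fin 3 → Fˣ)⁻¹ (τ 2) : Fˣ) : F)))⁻¹ : ℝ≥0) : ℝ) : ℂ) *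
        (if (finRotate 3)⁻¹ * τ = σ then 1 else 0) := by
  rw [Representation.parabolicIndGL, Representation.toFun_smoothIndRep_apply, _root_.mul_inv_rev, ← map_inv, permGL_inv, ← mul_assoc,
    K2E3GLnIwahoriHeckeCells.toFun_permGL_mul_diagonalGL_mul_permGL, hφv, Representation.twist_apply, MonoidHom.comp_apply,
    Representation.twist_apply, MonoidHom.one_apply, Representation.trivial_apply, Units.val_one, one_smul, smul_eq_mul,
    rootDeltaChar_diagonalGL_three]
  rfl

/-- `‖(d k)⁻¹‖` for `d = (ϖ, 1, 1)`: `q` at `k = 0`, else `1`. [folklore] -/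
theorem normAbs_dInv_apply {ϖ : F} (hϖ : (valuation F).IsUniformizer ϖ) (k : Fin 3) :
    normAbs F ((((![Units.mk0 ϖ hϖ.ne_zero, 1, 1] : Fin 3 → Fˣ)⁻¹ k : Fˣ) : F)) = if k = 0 then (Nat.card 𝓀[F] : ℝ≥0) else 1 := by
  have h := normAbs_uniformizer_holds hϖ
  fin_cases k
  · simp only [Pi.inv_apply, Fin.zero_eta, Fin.isValue, Matrix.cons_val_zero, Units.val_inv_eq_inv_val, Units.val_mk0, map_inv₀, h, inv_inv, if_true]
    rfl
  · simp
  · simp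

end GL3

/-! ## §3 The tables: in the lexicographic basis order the matrices ARE ★ IH-4's `T₁, T₂, P` -/

section Tables

variable {F : Type} [Field F] [ValuativeRel F] [TopologicalSpace F] [IsNonarchimedeanLocalField F]
  (χ : (Π a : Fin 3, GL {i : Fin 3 // (id : Fin 3 → Fin 3) i = a} F) →* ℂˣ)

/-- **TABLE `T₁`**: the matrix of `q·e_{Iw} π(P_{(0 1)})` in the basis `φ_{ι b}`, `ι = ![1, (1 2), (0 1), (0 1 2), (0 2 1), (0 2)]`, is K2E3-p11's literal `T₁`.
[cite: IwahoriMatsumoto1965, §3 Thm. 3.3] -/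
theorem table_T₁ (q : ℂ) :
    (Matrix.of fun a b : Fin 6 =>
      if (![1, Equiv.swap 1 2, Equiv.swap 0 1, finRotate 3, (finRotate 3)⁻¹, Equiv.swap 0 2] a : Equiv.Perm (Fin 3))⁻¹ 0 <
          (![1, Equiv.swap 1 2, Equiv.swap 0 1, finRotate 3, (finRotate 3)⁻¹, Equiv.swap 0 2] a : Equiv.Perm (Fin 3))⁻¹ 1 then
        q * (if Equiv.swap (0 : Fin 3) 1 * ![1, Equiv.swap 1 2, Equiv.swap 0 1, finRotate 3, (finRotate 3)⁻¹, Equiv.swap 0 2] a =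
          ![1, Equiv.swap 1 2, Equiv.swap 0 1, finRotate 3, (finRotate 3)⁻¹, Equiv.swap 0 2] b then 1 else 0)
      else (if Equiv.swap (0 : Fin 3) 1 * ![1, Equiv.swap 1 2, Equiv.swap 0 1, finRotate 3, (finRotate 3)⁻¹, Equiv.swap 0 2] a =
          ![1, Equiv.swap 1 2, Equiv.swap 0 1, finRotate 3, (finRotate 3)⁻¹, Equiv.swap 0 2] b then 1 else 0) +
        (q - 1) * (if ![1, Equiv.swap 1 2, Equiv.swap 0 1, finRotate 3, (finRotate 3)⁻¹, Equiv.swap 0 2] a =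
          ![1, Equiv.swap 1 2, Equiv.swap 0 1, finRotate 3, (finRotate 3)⁻¹, Equiv.swap 0 2] b then 1 else 0)) =
      !![0, 0, q, 0, 0, 0; 0, 0, 0, q, 0, 0; 1, 0, q - 1, 0, 0, 0; 0, 1, 0, q - 1, 0, 0; 0, 0, 0, 0, 0, q; 0, 0, 0, 0, 1, q - 1] := by
  ext a b
  fin_cases a <;> fin_cases b <;> simp (config := { decide := true })

/-- **TABLE `T₂`**: the matrix of `q·e_{Iw} π(P_{(1 2)})` in the basis `φ_{ι b}` is K2E3-p11's literal `T₂`. [cite: IwahoriMatsumoto1965, §3 Thm. 3.3] -/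
theorem table_T₂ (q : ℂ) :
    (Matrix.of fun a b : Fin 6 =>
      if (![1, Equiv.swap 1 2, Equiv.swap 0 1, finRotate 3, (finRotate 3)⁻¹, Equiv.swap 0 2] a : Equiv.Perm (Fin 3))⁻¹ 1 <
          (![1, Equiv.swap 1 2, Equiv.swap 0 1, finRotate 3, (finRotate 3)⁻¹, Equiv.swap 0 2] a : Equiv.Perm (Fin 3))⁻¹ 2 then
        q * (if Equiv.swap (1 : Fin 3) 2 * ![1, Equiv.swap 1 2, Equiv.swap 0 1, finRotate 3, (finRotate 3)⁻¹, Equiv.swap 0 2] a =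
          ![1, Equiv.swap 1 2, Equiv.swap 0 1, finRotate 3, (finRotate 3)⁻¹, Equiv.swap 0 2] b then 1 else 0)
      else (if Equiv.swap (1 : Fin 3) 2 * ![1, Equiv.swap 1 2, Equiv.swap 0 1, finRotate 3, (finRotate 3)⁻¹, Equiv.swap 0 2] a =
          ![1, Equiv.swap 1 2, Equiv.swap 0 1, finRotate 3, (finRotate 3)⁻¹, Equiv.swap 0 2] b then 1 else 0) +
        (q - 1) * (if ![1, Equiv.swap 1 2, Equiv.swap 0 1, finRotate 3, (finRotate 3)⁻¹, Equiv.swap 0 2] a =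
          ![1, Equiv.swap 1 2, Equiv.swap 0 1, finRotate 3, (finRotate 3)⁻¹, Equiv.swap 0 2] b then 1 else 0)) =
      !![0, q, 0, 0, 0, 0; 1, q - 1, 0, 0, 0, 0; 0, 0, 0, 0, q, 0; 0, 0, 0, 0, 0, q; 0, 0, 1, 0, q - 1, 0; 0, 0, 0, 1, 0, q - 1] := by
  ext a b
  fin_cases a <;> fin_cases b <;> simp (config := { decide := true })

/-- **TABLE `P`**: the matrix of `π(r⁻¹)` in the basis `φ_{ι b}` (entries `q^{[τ 0 = 0] − [τ 2 = 0]} · [σ = (0 2 1)τ]`, `τ = ι a`, `σ = ι b`) is K2E3-p11's literal `P`.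
[cite: IwahoriMatsumoto1965, §3] -/
theorem table_P (q : ℂ) :
    (Matrix.of fun a b : Fin 6 =>
      ((if (![1, Equiv.swap 1 2, Equiv.swap 0 1, finRotate 3, (finRotate 3)⁻¹, Equiv.swap 0 2] a : Equiv.Perm (Fin 3)) 0 = 0 then q else 1) *
        (if (![1, Equiv.swap 1 2, Equiv.swap 0 1, finRotate 3, (finRotate 3)⁻¹, Equiv.swap 0 2] a : Equiv.Perm (Fin 3)) 2 = 0 then q else 1)⁻¹) *
      (if (finRotate 3)⁻¹ * ![1, Equiv.swap 1 2, Equiv.swap 0 1, finRotate 3, (finRotate 3)⁻¹, Equiv.swap 0 2] a =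
          ![1, Equiv.swap 1 2, Equiv.swap 0 1, finRotate 3, (finRotate 3)⁻¹, Equiv.swap 0 2] b then 1 else 0)) =
      !![0, 0, 0, 0, q, 0; 0, 0, 0, 0, 0, q; 0, 1, 0, 0, 0, 0; q⁻¹, 0, 0, 0, 0, 0; 0, 0, 0, 1, 0, 0; 0, 0, q⁻¹, 0, 0, 0] := by
  ext a b
  fin_cases a <;> fin_cases b <;> simp (config := { decide := true })

end Tables


end Summit.HodgeConjecture.HodgeConjecture.Cruxes.H413.K2E3GL3IwahoriHeckeMatrices

end
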